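import Literature.NumberTheory.Transcendental.CurvePeriodsChartPathsProofs
import HarnessLib

/-!
# Periods of curve type: grids of paths — the combinatorial assembly

Companion of `Literature/NumberTheory/Transcendental/CurvePeriods.lean` (Huber–Wüstholz 2022,
Thm. 13.3 (2), rendered on explicit period symbols `(Z, ω, γ)` with the elementary relations
(R1)–(R5); the general statement is the named fact `HuberWustholzCurvePeriods`). To show that a
CONTINUOUS homotopy between two `C¹` paths on a smooth affine curve `Z` gives the same symbol,
the square is cut into an `N × N` grid of cells each mapped into one holomorphic chart, the
vertices are replaced by algebraic points and the edges by `C¹` paths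
(`CurvePeriodsChartPathsProofs.lean`, `…PathConnectedProofs.lean`, `…VertexAdjustProofs.lean`).
This file contains the two purely combinatorial steps of that argument, valid for any family of
edge paths:

* `span_grid_sides` — if every cell `(p, q)` has its four edge paths (bottom `eh p q`, right
  `ev (p+1) q`, top `eh p (q+1)`, left `ev p q`, glued at vertex points `A p q`) inside one chart
  neighbourhood `Ωc p q`, then the sum over the cells of the cell relations
  (`span_cell_of_subset_chart`) telescopes (`grid_telescope`): modulo relations,
  `Σ_q (ev N q) − Σ_q (ev 0 q) ∼ Σ_p (eh p N) − Σ_p (eh p 0)`, and if the bottom and top edges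
  are themselves relations (constant paths), `Σ_q (Z, ω, ev N q) ∼ Σ_q (Z, ω, ev 0 q)`;
* `CurvePath.gridPiece`, `span_single_sub_sum_gridPiece` — a `C¹` path whose values at the grid
  parameters `q / N` are algebraic points is, modulo relations, the sum of its `N` pieces
  (iterated subdivision, `rel_subdivision`).

## References

* A. Huber, G. Wüstholz, *Transcendence and Linear Relations of 1-Periods*, Cambridge Tracts in
  Mathematics 227, CUP 2022 [HuberWustholz2022]: §3.3.1 (pp. 42–44 of the held text), Thm. 13.3 (2)
  (p. 121).
-/

noncomputable section

open scoped BigOperators Topology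
open MvPolynomial Set Filter Metric Finset

namespace Literature.NumberTheory.Transcendental

namespace CurvePeriods

set_option quotPrecheck false in
/-- Membership in the `ℚ̄`-span of the elementary relations, in the format of the conclusion of
`HuberWustholzCurvePeriods`. -/
local notation "InSpan" c:max => ∃ (k : ℕ) (ρ : Fin k → (PeriodSymbol →₀ ℂ)) (a : Fin k → ℂ),
  (∀ l, IsElementaryRelation (ρ l)) ∧ (∀ l, IsAlgebraic ℚ (a l)) ∧ c = ∑ l, a l • ρ l

variable {Z : CurveData}

/-! ### Sums -/

/-- The span is closed under sums over `range N`. [folklore] -/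
theorem span_sum_range (f : ℕ → (PeriodSymbol →₀ ℂ)) (N : ℕ) (hf : ∀ i, i < N → InSpan (f i)) :
    InSpan (∑ i ∈ range N, f i) := by
  induction N with
  | zero => rw [sum_range_zero]; exact span_zero
  | succ N ih =>
    rw [sum_range_succ]
    exact span_add (ih fun i hi => hf i (Nat.lt_succ_of_lt hi)) (hf N (Nat.lt_succ_self N))

/-- **Telescoping over a grid**: summing `b(p,q) + l(p+1,q) − b(p,q+1) − l(p,q)` over the cells
`p, q < N` leaves the boundary terms. [folklore] -/
theorem grid_telescope {M : Type*} [AddCommGroup M] (b l : ℕ → ℕ → M) (N : ℕ) :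
    ∑ p ∈ range N, ∑ q ∈ range N, (b p q + l (p + 1) q - b p (q + 1) - l p q) =
      ∑ p ∈ range N, (b p 0 - b p N) + ∑ q ∈ range N, (l N q - l 0 q) := by
  have hsplit : ∀ p q, b p q + l (p + 1) q - b p (q + 1) - l p q =
      (b p q - b p (q + 1)) + (l (p + 1) q - l p q) := fun p q => by abel
  simp_rw [hsplit, sum_add_distrib]
  congr 1
  · exact sum_congr rfl fun p _ => sum_range_sub' (fun q => b p q) N
  · rw [sum_comm]
    exact sum_congr rfl fun q _ => sum_range_sub (fun p => l p q) N

/-! ### The cell relations of a grid, summed -/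

section Grid

variable (hZ : Z.IsSmoothAffineCurve) (ω : Fin Z.n → MvPolynomial (Fin Z.n) ℂ)
  (h : ∀ i, HasAlgCoeffs (ω i)) (N : ℕ)
  (ι : ℕ → ℕ → Fin Z.n) (cc : ℕ → ℕ → ℂ) (εc : ℕ → ℕ → ℝ) (Ωc : ℕ → ℕ → Set (Fin Z.n → ℂ))
  (ψc : ℕ → ℕ → ℂ → (Fin Z.n → ℂ))
  (hψc : ∀ p q, p < N → q < N → AnalyticOnNhd ℂ (ψc p q) (ball (cc p q) (εc p q)))
  (h1c : ∀ p q, p < N → q < N → ∀ z ∈ Ωc p q, z ∈ Z.points →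
    z (ι p q) ∈ ball (cc p q) (εc p q) ∧ ψc p q (z (ι p q)) = z)
  (h2c : ∀ p q, p < N → q < N → ∀ w ∈ ball (cc p q) (εc p q),
    ψc p q w ∈ Ωc p q ∧ ψc p q w ∈ Z.points ∧ ψc p q w (ι p q) = w)
  (A : ℕ → ℕ → (Fin Z.n → ℂ)) (eh ev : ℕ → ℕ → CurvePath Z)
  (heh0 : ∀ p q, p < N → q ≤ N → (eh p q).toFun 0 = A p q)
  (heh1 : ∀ p q, p < N → q ≤ N → (eh p q).toFun 1 = A (p + 1) q)
  (hev0 : ∀ p q, p ≤ N → q < N → (ev p q).toFun 0 = A p q)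
  (hev1 : ∀ p q, p ≤ N → q < N → (ev p q).toFun 1 = A p (q + 1))
  (hb : ∀ p q, p < N → q < N → ∀ t ∈ Icc (0 : ℝ) 1, (eh p q).toFun t ∈ Ωc p q)
  (ht : ∀ p q, p < N → q < N → ∀ t ∈ Icc (0 : ℝ) 1, (eh p (q + 1)).toFun t ∈ Ωc p q)
  (hl : ∀ p q, p < N → q < N → ∀ t ∈ Icc (0 : ℝ) 1, (ev p q).toFun t ∈ Ωc p q)
  (hr : ∀ p q, p < N → q < N → ∀ t ∈ Icc (0 : ℝ) 1, (ev (p + 1) q).toFun t ∈ Ωc p q)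

include hψc h1c h2c heh0 heh1 hev0 hev1 hb ht hl hr in
/-- **The cell relations of a grid sum to the boundary.** With edge paths as in the section
variables (every cell's four edges inside its chart neighbourhood),
`Σ_p ((eh p 0) − (eh p N)) + Σ_q ((ev N q) − (ev 0 q))` lies in the span of the elementary
relations. [cite: HuberWustholz2022, §3.3.1 (pp. 42–44)] -/
theorem span_grid_boundary :
    InSpan (∑ p ∈ range N, (Finsupp.single (⟨Z, hZ, ω, h, eh p 0⟩ : PeriodSymbol) (1 : ℂ) -
        Finsupp.single (⟨Z, hZ, ω, h, eh p N⟩ : PeriodSymbol) (1 : ℂ)) +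
      ∑ q ∈ range N, (Finsupp.single (⟨Z, hZ, ω, h, ev N q⟩ : PeriodSymbol) (1 : ℂ) -
        Finsupp.single (⟨Z, hZ, ω, h, ev 0 q⟩ : PeriodSymbol) (1 : ℂ))) := by
  rw [← grid_telescope (fun p q => Finsupp.single (⟨Z, hZ, ω, h, eh p q⟩ : PeriodSymbol) (1 : ℂ))
    (fun p q => Finsupp.single (⟨Z, hZ, ω, h, ev p q⟩ : PeriodSymbol) (1 : ℂ)) N]
  refine span_sum_range _ N fun p hp => span_sum_range _ N fun q hq => ?_
  exact span_cell_of_subset_chart hZ ω h (hψc p q hp hq) (h1c p q hp hq) (h2c p q hp hq)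
    (eh p q) (ev (p + 1) q) (eh p (q + 1)) (ev p q) (hb p q hp hq) (hr p q hp hq) (ht p q hp hq)
    (hl p q hp hq) (by rw [heh1 p q hp hq.le, hev0 (p + 1) q hp hq])
    (by rw [hev1 (p + 1) q hp hq, heh1 p (q + 1) hp hq])
    (by rw [heh0 p q hp hq.le, hev0 p q hp.le hq]) (by rw [heh0 p (q + 1) hp hq, hev1 p q hp.le hq])

include hψc h1c h2c heh0 heh1 hev0 hev1 hb ht hl hr in
/-- **The two sides of a grid have the same symbol sum** when the bottom and top edges are
relations (e.g. constant paths): `Σ_q (Z, ω, ev N q) − Σ_q (Z, ω, ev 0 q) ∼ 0`.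
[cite: HuberWustholz2022, §3.3.1 (pp. 42–44)] -/
theorem span_grid_sides
    (hbot : ∀ p, p < N → InSpan (Finsupp.single (⟨Z, hZ, ω, h, eh p 0⟩ : PeriodSymbol) (1 : ℂ)))
    (htop : ∀ p, p < N → InSpan (Finsupp.single (⟨Z, hZ, ω, h, eh p N⟩ : PeriodSymbol) (1 : ℂ))) :
    InSpan (∑ q ∈ range N, Finsupp.single (⟨Z, hZ, ω, h, ev N q⟩ : PeriodSymbol) (1 : ℂ) -
      ∑ q ∈ range N, Finsupp.single (⟨Z, hZ, ω, h, ev 0 q⟩ : PeriodSymbol) (1 : ℂ)) := by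
  have hB := span_grid_boundary hZ ω h N ι cc εc Ωc ψc hψc h1c h2c A eh ev heh0 heh1 hev0 hev1
    hb ht hl hr
  have hP : InSpan (∑ p ∈ range N, (Finsupp.single (⟨Z, hZ, ω, h, eh p 0⟩ : PeriodSymbol) (1 : ℂ) -
      Finsupp.single (⟨Z, hZ, ω, h, eh p N⟩ : PeriodSymbol) (1 : ℂ))) :=
    span_sum_range _ N fun p hp => span_sub (hbot p hp) (htop p hp)
  obtain ⟨k, ρ, a, hρ, ha, he⟩ := span_sub hB hP
  refine ⟨k, ρ, a, hρ, ha, ?_⟩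
  rw [← he]
  simp only [sum_sub_distrib]
  abel

end Grid

/-! ### A path is the sum of its grid pieces -/

section Pieces

variable (γ : CurvePath Z) (N : ℕ) (hN : 0 < N)
  (halg : ∀ q, q ≤ N → ∀ i, IsAlgebraic ℚ (γ.toFun ((q : ℝ) / N) i))

/-- `q / N ∈ [0,1]` for `q ≤ N`. [folklore] -/
theorem div_mem_Icc {q N : ℕ} (hN : 0 < N) (hq : q ≤ N) : (q : ℝ) / N ∈ Icc (0 : ℝ) 1 :=
  ⟨by positivity, (div_le_one (by exact_mod_cast hN)).mpr (by exact_mod_cast hq)⟩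

/-- `q / N + t / N ∈ [0,1]` for `q < N`, `t ∈ [0,1]`. [folklore] -/
theorem div_add_div_mem_Icc {q N : ℕ} (hN : 0 < N) (hq : q < N) {t : ℝ} (ht : t ∈ Icc (0 : ℝ) 1) :
    (q : ℝ) / N + t / N ∈ Icc (0 : ℝ) 1 := by
  have hN' : (0 : ℝ) < N := by exact_mod_cast hN
  have hq' : (q : ℝ) + 1 ≤ N := by exact_mod_cast hq
  constructor
  · have := ht.1; positivity
  · rw [← add_div, div_le_one hN']
    linarith [ht.2]

/-- **The `q`-th grid piece** `t ↦ γ(q/N + t/N)` of a path whose values at the parameters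
`q / N` are algebraic points (for `q ≥ N`, the constant path at `γ(0)`, unused). [folklore] -/
def CurvePath.gridPiece (q : ℕ) : CurvePath Z :=
  if hq : q < N then
    { toFun := fun t => γ.toFun ((q : ℝ) / N + t / N)
      contDiffOn := γ.contDiffOn.comp (contDiff_const.add (contDiff_id.div_const _)).contDiffOn
        fun _ ht => div_add_div_mem_Icc hN hq ht
      mem_points := fun _ ht => γ.mem_points _ (div_add_div_mem_Icc hN hq ht)
      algebraic_zero := fun i => by
        rw [zero_div, add_zero]
        exact halg q hq.le i
      algebraic_one := fun i => by
        have e : (q : ℝ) / N + 1 / N = ((q + 1 : ℕ) : ℝ) / N := by push_cast; ring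
        rw [e]
        exact halg (q + 1) hq i }
  else γ.firstPiece 0 ⟨le_rfl, zero_le_one⟩ γ.algebraic_zero

/-- The grid piece, unfolded (for `q < N`). [folklore] -/
theorem CurvePath.gridPiece_apply {q : ℕ} (hq : q < N) (t : ℝ) :
    (γ.gridPiece N hN halg q).toFun t = γ.toFun ((q : ℝ) / N + t / N) := by
  rw [CurvePath.gridPiece, dif_pos hq]

/-- The tail `t ↦ γ(q/N + (1 − q/N) t)` of the path from the parameter `q / N` on (`q ≤ N`).
[folklore] -/
def CurvePath.gridTail (q : ℕ) (hq : q ≤ N) : CurvePath Z :=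
  γ.secondPiece ((q : ℝ) / N) (div_mem_Icc hN hq) (halg q hq)

include hN in
/-- **One subdivision step**: `(piece q) + (tail (q+1)) − (tail q)` is an elementary relation.
[cite: HuberWustholz2022, §3.3.1 (pp. 42–44)] -/
theorem rel_gridPiece_add_gridTail_sub (hZ : Z.IsSmoothAffineCurve)
    (ω : Fin Z.n → MvPolynomial (Fin Z.n) ℂ) (h : ∀ i, HasAlgCoeffs (ω i)) {q : ℕ} (hq : q < N) :
    IsElementaryRelation
      (Finsupp.single (⟨Z, hZ, ω, h, γ.gridPiece N hN halg q⟩ : PeriodSymbol) (1 : ℂ) +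
        Finsupp.single (⟨Z, hZ, ω, h, γ.gridTail N hN halg (q + 1) hq⟩ : PeriodSymbol) (1 : ℂ) -
        Finsupp.single (⟨Z, hZ, ω, h, γ.gridTail N hN halg q hq.le⟩ : PeriodSymbol) (1 : ℂ)) := by
  have hN' : (0 : ℝ) < N := by exact_mod_cast hN
  have hNq : (0 : ℝ) < (N : ℝ) - q := by
    have : (q : ℝ) + 1 ≤ N := by exact_mod_cast hq
    linarith
  have hcI : (1 : ℝ) / ((N : ℝ) - q) ∈ Icc (0 : ℝ) 1 :=
    ⟨by positivity, (div_le_one hNq).mpr (by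
      have : (q : ℝ) + 1 ≤ N := by exact_mod_cast hq
      linarith)⟩
  refine rel_subdivision hZ ω h (γ.gridTail N hN halg q hq.le) (γ.gridPiece N hN halg q)
    (γ.gridTail N hN halg (q + 1) hq) hcI (fun t _ => ?_) (fun t _ => ?_)
  · rw [CurvePath.gridPiece_apply γ N hN halg hq]
    show γ.toFun ((q : ℝ) / N + t / N) =
      γ.toFun ((q : ℝ) / N + (1 - (q : ℝ) / N) * (1 / ((N : ℝ) - q) * t))
    congr 1
    field_simp
  · show γ.toFun ((((q + 1 : ℕ) : ℝ)) / N + (1 - ((q + 1 : ℕ) : ℝ) / N) * t) =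
      γ.toFun ((q : ℝ) / N + (1 - (q : ℝ) / N) * (1 / ((N : ℝ) - q) + (1 - 1 / ((N : ℝ) - q)) * t))
    congr 1
    push_cast
    field_simp
    ring

include hN in
/-- **A path is the sum of its grid pieces, modulo relations**: if `γ(q/N)` is an algebraic point
for all `0 ≤ q ≤ N`, then `(Z, ω, γ) − Σ_{q<N} (Z, ω, γ|[q/N,(q+1)/N]) ∼ 0`.
[cite: HuberWustholz2022, §3.3.1 (pp. 42–44)] -/
theorem span_single_sub_sum_gridPiece (hZ : Z.IsSmoothAffineCurve)
    (ω : Fin Z.n → MvPolynomial (Fin Z.n) ℂ) (h : ∀ i, HasAlgCoeffs (ω i)) :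
    InSpan (Finsupp.single (⟨Z, hZ, ω, h, γ⟩ : PeriodSymbol) (1 : ℂ) -
      ∑ q ∈ range N, Finsupp.single (⟨Z, hZ, ω, h, γ.gridPiece N hN halg q⟩ : PeriodSymbol) (1 : ℂ)) := by
  -- `S q = Σ_{q' < q} piece q' + tail q`; `S q − tail 0 ∼ 0` by induction
  have hstep : ∀ q (hq : q ≤ N), InSpan
      (∑ q' ∈ range q, Finsupp.single (⟨Z, hZ, ω, h, γ.gridPiece N hN halg q'⟩ : PeriodSymbol) (1 : ℂ) +
        Finsupp.single (⟨Z, hZ, ω, h, γ.gridTail N hN halg q hq⟩ : PeriodSymbol) (1 : ℂ) -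
        Finsupp.single (⟨Z, hZ, ω, h, γ.gridTail N hN halg 0 (Nat.zero_le N)⟩ : PeriodSymbol)
          (1 : ℂ)) := by
    intro q
    induction q with
    | zero => intro _; rw [sum_range_zero, zero_add, sub_self]; exact span_zero
    | succ q ih =>
      intro hq
      have hq' : q < N := Nat.lt_of_succ_le hq
      have hrel := rel_gridPiece_add_gridTail_sub γ N hN halg hZ ω h hq'
      obtain ⟨k, ρ, a, hρ, ha, he⟩ := span_add (ih hq'.le) (span_of_rel hrel)
      refine ⟨k, ρ, a, hρ, ha, ?_⟩
      rw [← he, sum_range_succ]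
      abel
  -- `tail 0 = γ` on `[0,1]` and `tail N` is constant
  have h0 : InSpan (Finsupp.single (⟨Z, hZ, ω, h, γ⟩ : PeriodSymbol) (1 : ℂ) -
      Finsupp.single (⟨Z, hZ, ω, h, γ.gridTail N hN halg 0 (Nat.zero_le N)⟩ : PeriodSymbol) (1 : ℂ)) :=
    mem_span_sub_of_eqOn hZ ω h γ _ fun t _ => by
      show γ.toFun (((0 : ℕ) : ℝ) / N + (1 - ((0 : ℕ) : ℝ) / N) * t) = γ.toFun t
      rw [Nat.cast_zero, zero_div, zero_add, sub_zero, one_mul]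
  have hNc : IsElementaryRelation
      (Finsupp.single (⟨Z, hZ, ω, h, γ.gridTail N hN halg N le_rfl⟩ : PeriodSymbol) (1 : ℂ)) :=
    isElementaryRelation_single_of_const hZ ω h _ (γ.toFun 1) fun t _ => by
      show γ.toFun ((N : ℝ) / N + (1 - (N : ℝ) / N) * t) = γ.toFun 1
      rw [div_self (by exact_mod_cast hN.ne'), sub_self, zero_mul, add_zero]
  obtain ⟨k, ρ, a, hρ, ha, he⟩ := span_add (span_sub h0 (hstep N le_rfl)) (span_of_rel hNc)
  exact ⟨k, ρ, a, hρ, ha, by rw [← he]; abel⟩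

end Pieces

end CurvePeriods

end Literature.NumberTheory.Transcendental

end
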